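import Literature.AlgebraicGeometry.Motives.AbelianVarietyTorsionStalkTower
import Literature.AlgebraicGeometry.Motives.AbelianVarietyTorsionCotangent
import Literature.AlgebraicGeometry.Motives.CyclesEquivalencesFlatPullbackProofs
import HarnessLib

/-!
# The local ring of `A[N]` at the origin is `𝒪_{A,e} ⧸ [N]^♯ 𝔪_e · 𝒪_{A,e}`

Topic `Literature/AlgebraicGeometry/Motives`; namespace `Literature.AlgebraicGeometry.Motives`.  THEOREMS ONLY (no definition, no named
fact, no instance, no notation, no `sorry`).  Cell `hodgecm-mathlib` (D-0151), P6b wave B, B8′ (J3b) «STALK OF THE FIBRE AT THE ORIGIN,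
abelian-variety form» (desk F0P6b-plan (g13) DEALS v7 (5)); companion of ★ `AbelianVarietyTorsionStalkTower` (p853923, the tower
`I n := [pⁿ]^♯ 𝔪_e · 𝒪_{A,e}`) and ★ `RingTheory/RegularLocalRing/PowerSeriesQuotientTower` (p853921), which together present the quotient
tower `𝒪_{A,e} ⧸ I n` by `K⟦X₁,…,X_g⟧`; this file identifies those quotients with the local rings of the torsion subgroup schemes
`A[N]` at their unit point — the `Spec`-side step of [Tate1967] §2.2 («`A_ν`» there) at the special fibre.

For an abelian scheme `𝒜` over `Spec K` (`K` a field), `A := 𝒜.toAffine.toAbelianVariety` its abelian-variety avatar (same `K`-group scheme),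
and ANY kernel presentation `i : G ⟶ 𝒜` of `[N]` — a cartesian square `G →(i) 𝒜 →([N]) 𝒜 ←(e) Spec K` in `Over (Spec K)` (e.g. ★ `𝒜.torsion N`
with ★ `isPullback_torsionι`, or the layers of a Barsotti–Tate group through a torsion tower) — and a point `w ∈ G` over the origin:

* `surjective_stalkMap_of_isPullback_mulN`: the stalk map `𝒪_{𝒜,e} ⟶ 𝒪_{G,w}` of `i` is SURJECTIVE (`i` is a base change of the closed
  immersion `e`);
* **`ker_stalkMap_of_isPullback_mulN`**: its KERNEL is `[N]^♯ 𝔪_e · 𝒪_{𝒜,e}` = ★ p853923's ideal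
  `(maximalIdeal (stalkOrigin A)).map (stalkMapEnd A ((N : ℤ) • 𝟙 A)).hom` — the stalk computation `𝒪_{G,w} = 𝒪_{𝒜,e} ⊗_{𝒪_{𝒜,[N]e}} K` of ★
  `Motives.ker_stalkMap_of_isPullback` with `ker (e^♯ : 𝒪_{𝒜,e} → K) = 𝔪_e`;
* `stalkMap_stalkOriginAlgebraMap_of_over`: it is a `K`-ALGEBRA map (the structure maps `K → 𝒪_{𝒜,e} → 𝒪_{G,w}` and `K → 𝒪_{G,w}` agree);
* **`exists_ringEquiv_stalk_quotient_of_isPullback_mulN`**: hence `𝒪_{G,w} ≅ 𝒪_{𝒜,e} ⧸ [N]^♯ 𝔪_e · 𝒪_{𝒜,e}`, compatibly with the two maps from `𝒪_{𝒜,e}`.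

HONEST LABEL: count-neutral organ of the P6b sub-line (hLiu418 = stmt-HodgeConjecture-24832 side); HC_CM is proved only modulo the printed
citations (2 remaining named inputs hLiu418, h413) until rung 0 closes.

## References
* [Tate1967] J. T. Tate, *p-divisible groups*, Proc. Conf. Local Fields (Driebergen 1966), Springer 1967: §2.2, proof of Prop. 1.
* [GortzWedhorn2023] U. Görtz, T. Wedhorn, *Algebraic Geometry II* (2023): Prop. 27.188 (1) (p. 675).
* [GortzWedhorn2020] U. Görtz, T. Wedhorn, *Algebraic Geometry I*, 2nd ed. (2020): Section (4.7) (base change), Remark 6.3 (3).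
-/

set_option autoImplicit false

noncomputable section

universe u

open CategoryTheory CategoryTheory.Limits AlgebraicGeometry MonoidalCategory CartesianMonoidalCategory IsLocalRing
open scoped MonObj

namespace Literature.AlgebraicGeometry.Motives

/-! ## §0 Two ring-form trivialities -/

section RingForm

variable {R S : Type*} [CommRing R] [CommRing S] [IsLocalRing R] [IsLocalRing S]

/-- The kernel of a local homomorphism into a local ring with zero maximal ideal (a field) is the maximal ideal. [cite: GortzWedhorn2020, Remark 6.3 (3)] -/
theorem RingHom.ker_eq_maximalIdeal_of_maximalIdeal_eq_bot (f : R →+* S) [IsLocalHom f]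
    (hS : maximalIdeal S = ⊥) : RingHom.ker f = maximalIdeal R := by
  ext x
  rw [RingHom.mem_ker]
  constructor
  · intro hx
    rw [mem_maximalIdeal, mem_nonunits_iff]
    intro hu
    have h := hu.map f
    rw [hx] at h
    exact not_isUnit_zero h
  · intro hx
    have h : f x ∈ maximalIdeal S := map_nonunit f x hx
    rwa [hS, Ideal.mem_bot] at h

/-- A ring isomorphism of local rings maps the maximal ideal ONTO the maximal ideal. [cite: GortzWedhorn2020, Remark 6.3 (3)] -/
theorem Ideal.map_maximalIdeal_of_ringEquiv (e : R ≃+* S) : (maximalIdeal R).map e.toRingHom = maximalIdeal S := by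
  apply le_antisymm
  · rw [Ideal.map_le_iff_le_comap]
    intro x hx
    rw [Ideal.mem_comap, mem_maximalIdeal, mem_nonunits_iff]
    rw [mem_maximalIdeal, mem_nonunits_iff] at hx
    intro hu
    apply hx
    simpa using hu.map e.symm.toRingHom
  · intro y hy
    have hy' : e.symm y ∈ maximalIdeal R := by
      rw [mem_maximalIdeal, mem_nonunits_iff] at hy ⊢
      intro hu
      apply hy
      simpa using hu.map e.toRingHom
    have : y = e.toRingHom (e.symm y) := (e.apply_symm_apply y).symm
    rw [this]
    exact Ideal.mem_map_of_mem _ hy'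

end RingForm

/-! ## §1 The stalk of a kernel presentation of `[N]` at a point over the origin -/

namespace AbelianSchemeOver

open Literature.AlgebraicGeometry.AbelianSchemes AbelianVariety

variable {K : Type u} [Field K] (𝒜 : AbelianSchemeOver (Spec (.of K)))

/-- The scheme morphism underlying `[N]_A = (N : ℤ) • 𝟙 A` of the abelian-variety avatar is `[N] = mulN N` of the abelian scheme
(★ `nsmul_id_hom_eq_mulN`). [cite: GortzWedhorn2023, Prop. 27.188 (1) (p. 675)] -/
theorem toSchemeHom_natCast_zsmul_id (N : ℕ) :
    Hom.toSchemeHom (((N : ℕ) : ℤ) • 𝟙 𝒜.toAffine.toAbelianVariety) = (𝒜.mulN N).left := by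
  rw [natCast_zsmul]
  exact congrArg CommaMorphism.left (nsmul_id_hom_eq_mulN 𝒜 N)

variable {𝒜}
variable {N : ℕ} {G : Over (Spec (.of K))} {i : G ⟶ 𝒜.X}

/-- The underlying square of schemes of a kernel presentation of `[N]`, flipped so that the preimmersion `e : Spec K → 𝒜` is the
base-changed leg: `G → Spec K`, `G →(i) 𝒜`, `e`, `[N]`. [cite: GortzWedhorn2020, Section (4.7) (pp. 107–108)] -/
theorem isPullback_left_flip_of_isPullback_mulN (H : IsPullback i (toUnit G) (𝒜.mulN N) η[𝒜.X]) :
    IsPullback (toUnit G).left i.left (unitPt 𝒜.toAffine.toAbelianVariety)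
      (Hom.toSchemeHom (((N : ℕ) : ℤ) • 𝟙 𝒜.toAffine.toAbelianVariety)) := by
  rw [toSchemeHom_natCast_zsmul_id]
  exact (H.map (Over.forget _)).flip

/-- For a point `w ∈ G` over the origin, `[N] (i w) = e (π w)` — the compatibility of points needed by ★ `ker_stalkMap_of_isPullback`.
[cite: GortzWedhorn2023, Prop. 27.188 (1) (p. 675)] -/
theorem toSchemeHom_origin_eq_unitPt (N : ℕ) (w : ↥G.left) :
    (Hom.toSchemeHom (((N : ℕ) : ℤ) • 𝟙 𝒜.toAffine.toAbelianVariety)).base (origin 𝒜.toAffine.toAbelianVariety) =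
      (unitPt 𝒜.toAffine.toAbelianVariety).base ((toUnit G).left.base w) := by
  rw [toSchemeHom_origin, eq_specPt K ((toUnit G).left.base w)]

/-- **The stalk map `𝒪_{𝒜,e} → 𝒪_{G,w}` of a kernel presentation of `[N]` is surjective** (base change of the closed immersion `e`).
[cite: GortzWedhorn2020, Section (4.7) (pp. 107–108)] -/
theorem surjective_stalkMap_of_isPullback_mulN (H : IsPullback i (toUnit G) (𝒜.mulN N) η[𝒜.X]) (w : ↥G.left)
    (hw : i.left.base w = origin 𝒜.toAffine.toAbelianVariety) :
    Function.Surjective ((𝒜.X.left.presheaf.stalkCongr (.of_eq hw)).inv ≫ i.left.stalkMap w).hom := by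
  rw [CommRingCat.hom_comp]
  exact (stalkMap_surjective_of_isPullback (isPullback_left_flip_of_isPullback_mulN H) w).comp
    (ConcreteCategory.bijective_of_isIso _).2

/-- **KERNEL OF THE STALK MAP OF A KERNEL PRESENTATION OF `[N]` AT THE ORIGIN.**  For a cartesian square `G →(i) 𝒜 →([N]) 𝒜 ←(e) Spec K`
in `Over (Spec K)` and `w ∈ G` over the origin, the kernel of `𝒪_{𝒜,e} → 𝒪_{G,w}` is `[N]^♯ 𝔪_e · 𝒪_{𝒜,e}` — the ideal
`(maximalIdeal (stalkOrigin A)).map (stalkMapEnd A ((N : ℤ) • 𝟙 A)).hom` of ★ `AbelianVarietyTorsionStalkTower` (`A := 𝒜.toAffine.toAbelianVariety`).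
Proof: ★ `ker_stalkMap_of_isPullback` (`𝒪_{G,w} = 𝒪_{𝒜,e} ⊗_{𝒪_{𝒜,[N]e}} 𝒪_{Spec K}`), the kernel of the local map `e^♯ : 𝒪_{𝒜,e} → K` being `𝔪_e`,
and transport along `[N] e = e`. [cite: Tate1967, §2.2 (proof of Prop. 1)] [cite: GortzWedhorn2023, Prop. 27.188 (1) (p. 675)] -/
theorem ker_stalkMap_of_isPullback_mulN (H : IsPullback i (toUnit G) (𝒜.mulN N) η[𝒜.X]) (w : ↥G.left)
    (hw : i.left.base w = origin 𝒜.toAffine.toAbelianVariety) :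
    RingHom.ker ((𝒜.X.left.presheaf.stalkCongr (.of_eq hw)).inv ≫ i.left.stalkMap w).hom =
      (maximalIdeal (stalkOrigin 𝒜.toAffine.toAbelianVariety)).map
        (stalkMapEnd 𝒜.toAffine.toAbelianVariety (((N : ℕ) : ℤ) • 𝟙 _)).hom := by
  have Hs := isPullback_left_flip_of_isPullback_mulN H
  have hy := toSchemeHom_origin_eq_unitPt (𝒜 := 𝒜) (G := G) N w
  rw [ker_stalkMap_of_isPullback Hs w (origin 𝒜.toAffine.toAbelianVariety) hw hy]
  -- the transported unit-section stalk map `𝒪_{𝒜, [N] e} ≅ 𝒪_{𝒜, e} → 𝒪_{Spec K}` and the transport `𝒪_{𝒜,[N] e} ≅ 𝒪_{𝒜,e}`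
  let ψ := (𝒜.toAffine.toAbelianVariety.X.left.presheaf.stalkCongr (.of_eq hy)).hom ≫
    (unitPt 𝒜.toAffine.toAbelianVariety).stalkMap ((toUnit G).left.base w)
  let c := 𝒜.toAffine.toAbelianVariety.X.left.presheaf.stalkCongr
    (.of_eq (toSchemeHom_origin (((N : ℕ) : ℤ) • 𝟙 𝒜.toAffine.toAbelianVariety)))
  haveI : IsLocalHom ψ.hom := by
    dsimp only [ψ]
    rw [CommRingCat.hom_comp]
    infer_instance
  -- `ker ψ = 𝔪_{[N] e}` (local map into a field) `= c⁻¹(𝔪_e)` (transport along `[N] e = e`)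
  have hker : RingHom.ker ψ.hom = maximalIdeal _ :=
    RingHom.ker_eq_maximalIdeal_of_maximalIdeal_eq_bot ψ.hom
      (by rw [eq_specPt K ((toUnit G).left.base w)]; exact maximalIdeal_stalk_specPt K)
  have hc : (maximalIdeal (stalkOrigin 𝒜.toAffine.toAbelianVariety)).map c.inv.hom = maximalIdeal _ :=
    Ideal.map_maximalIdeal_of_ringEquiv c.symm.commRingCatIsoToRingEquiv
  have e1 : RingHom.ker ψ.hom = (maximalIdeal (stalkOrigin 𝒜.toAffine.toAbelianVariety)).map c.inv.hom :=
    hker.trans hc.symm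
  refine (congrArg (Ideal.map ((Hom.toSchemeHom (((N : ℕ) : ℤ) • 𝟙 𝒜.toAffine.toAbelianVariety)).stalkMap
    (origin 𝒜.toAffine.toAbelianVariety)).hom) e1).trans ?_
  rw [Ideal.map_map, stalkMapEnd, CommRingCat.hom_comp]

/-- **The stalk map is a `K`-ALGEBRA map**: on the structure map `K → 𝒪_{𝒜,e}` (★ `stalkOriginAlgebraMap`) it returns the structure map
`K → 𝒪_{G,w}` (`i` is a morphism OVER `Spec K`). [cite: GortzWedhorn2020, Section (4.7) (pp. 107–108)] -/
theorem stalkMap_stalkOriginAlgebraMap_of_over (w : ↥G.left) (hw : i.left.base w = origin 𝒜.toAffine.toAbelianVariety) (c : K) :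
    ((𝒜.X.left.presheaf.stalkCongr (.of_eq hw)).inv ≫ i.left.stalkMap w) (stalkOriginAlgebraMap 𝒜.toAffine.toAbelianVariety c) =
      G.left.presheaf.germ ⊤ w trivial (G.hom.appTop ((Scheme.ΓSpecIso (.of K)).inv c)) := by
  set A := 𝒜.toAffine.toAbelianVariety with hA
  rw [stalkOriginAlgebraMap_apply, CommRingCat.comp_apply]
  have h1 : (𝒜.X.left.presheaf.stalkCongr (.of_eq hw)).inv
        (A.X.left.presheaf.germ ⊤ (origin A) trivial (A.X.hom.appTop ((Scheme.ΓSpecIso (.of K)).inv c))) =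
      𝒜.X.left.presheaf.germ ⊤ (i.left.base w) trivial (A.X.hom.appTop ((Scheme.ΓSpecIso (.of K)).inv c)) := by
    rw [TopCat.Presheaf.stalkCongr_inv]
    exact TopCat.Presheaf.germ_stalkSpecializes_apply _ _ _ _
  rw [h1, Scheme.Hom.germ_stalkMap_apply]
  exact congrArg (fun g : G.left ⟶ Spec (.of K) => G.left.presheaf.germ ⊤ w trivial (g.appTop ((Scheme.ΓSpecIso (.of K)).inv c)))
    (Over.w i)

/-- **`𝒪_{G,w} ≅ 𝒪_{𝒜,e} ⧸ [N]^♯ 𝔪_e · 𝒪_{𝒜,e}`** for a kernel presentation `G` of `[N]` and `w ∈ G` over the origin, compatibly with the stalk map and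
the quotient map (so, with ★ p853921 + ★ p853923, `𝒪_{A[pⁿ], e}` is presented by `K⟦X₁,…,X_g⟧`: [Tate1967] §2.2's tower `A_ν` at the special fibre).
[cite: Tate1967, §2.2 (proof of Prop. 1)] [cite: GortzWedhorn2023, Prop. 27.188 (1) (p. 675)] -/
theorem exists_ringEquiv_stalk_quotient_of_isPullback_mulN (H : IsPullback i (toUnit G) (𝒜.mulN N) η[𝒜.X]) (w : ↥G.left)
    (hw : i.left.base w = origin 𝒜.toAffine.toAbelianVariety) :
    ∃ e : ↥(G.left.presheaf.stalk w) ≃+*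
        ↥(stalkOrigin 𝒜.toAffine.toAbelianVariety) ⧸ (maximalIdeal (stalkOrigin 𝒜.toAffine.toAbelianVariety)).map
          (stalkMapEnd 𝒜.toAffine.toAbelianVariety (((N : ℕ) : ℤ) • 𝟙 _)).hom,
      ∀ x, e (((𝒜.X.left.presheaf.stalkCongr (.of_eq hw)).inv ≫ i.left.stalkMap w) x) = Ideal.Quotient.mk _ x := by
  set q := ((𝒜.X.left.presheaf.stalkCongr (.of_eq hw)).inv ≫ i.left.stalkMap w).hom with hq
  have hsurj : Function.Surjective q := surjective_stalkMap_of_isPullback_mulN H w hw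
  have hker := ker_stalkMap_of_isPullback_mulN H w hw
  refine ⟨(RingHom.quotientKerEquivOfSurjective hsurj).symm.trans (Ideal.quotEquivOfEq hker), fun x => ?_⟩
  change ((RingHom.quotientKerEquivOfSurjective hsurj).symm.trans (Ideal.quotEquivOfEq hker)) (q x) = _
  rw [RingEquiv.trans_apply]
  have h1 : (RingHom.quotientKerEquivOfSurjective hsurj).symm (q x) = Ideal.Quotient.mk _ x := by
    apply (RingHom.quotientKerEquivOfSurjective hsurj).injective
    rw [RingEquiv.apply_symm_apply]
    rfl
  rw [h1]
  rfl

/-- The case `G := A[N] = 𝒜.torsion N`, `i := torsionι` (★ `isPullback_torsionι`). [cite: GortzWedhorn2023, Prop. 27.188 (1) (p. 675)] -/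
theorem ker_stalkMap_torsionι (N : ℕ) (w : ↥(𝒜.torsion N).left) (hw : (𝒜.torsionι N).left.base w = origin 𝒜.toAffine.toAbelianVariety) :
    Function.Surjective ((𝒜.X.left.presheaf.stalkCongr (.of_eq hw)).inv ≫ (𝒜.torsionι N).left.stalkMap w).hom ∧
    RingHom.ker ((𝒜.X.left.presheaf.stalkCongr (.of_eq hw)).inv ≫ (𝒜.torsionι N).left.stalkMap w).hom =
      (maximalIdeal (stalkOrigin 𝒜.toAffine.toAbelianVariety)).map
        (stalkMapEnd 𝒜.toAffine.toAbelianVariety (((N : ℕ) : ℤ) • 𝟙 _)).hom :=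
  ⟨surjective_stalkMap_of_isPullback_mulN (𝒜.isPullback_torsionι N) w hw, ker_stalkMap_of_isPullback_mulN (𝒜.isPullback_torsionι N) w hw⟩

end AbelianSchemeOver

end Literature.AlgebraicGeometry.Motives

end
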